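import Literature.AlgebraicGeometry.Resolution.ImmediateRationalUniformization
import Literature.AlgebraicGeometry.Resolution.SeparablyDefectlessDenseDescent
import HarnessLib

/-!
# The dense transcendental step (`stub_denseTranscStep`)

Stub of the birth line of the crux `ShadowsUniformize` (route `AbhyankarShadows`): the
TRANSCENDENTAL step of the proof of Knaf–Kuhlmann 2009, Prop. 3.11 ("Let `(L|K,P)` be a
finitely generated, separable extension within the completion of `(K,P)`. Then `P` is strongly
smoothly `O_K`-uniformizable"), arXiv:math/0702856 §3.4:

> By assumption there exists a transcendence basis `T` of `L|K` such that `L|K(T)` is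
> separable-algebraic. By induction on the transcendence degree, using the Lemmata 2.16 and
> 3.9 and Corollary 3.6 we find that `P|_{K(T)}` is strongly smoothly `O_K`-uniformizable.

One step of that induction, in the ambient rendering of `ValuedFunctionFields.lean`: `(Ω, V)` a
valued field, `K : Subfield Ω`, `z ∈ Ω` transcendental over `K` (no non-zero polynomial with
coefficients in `K` vanishes at `z`) such that `K` is DENSE in `K(z) = Subfield.closure (K ∪ {z})`
(`IsDenseIn`, `SeparablyDefectlessDenseDescent.lean`: "`(K(z),P)` lies in the completion of
`(K,P)`"); conclusion: every finite `Z ⊆ O_V ∩ K(z)` is smoothly `O_K`-uniformizable in `K(z)`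
(`IsSmoothlyUniformizableIn ↥(V ∩ K) V K(z) Z`, `O_K = V ∩ K`).

Proof:
1. **Lemma 2.16, completion case** (`valuation_eval_eq_of_isDenseIn`,
   `kaplansky_condition_of_isDenseIn`; the tree so far only had the separably closed case,
   `kaplansky_condition_of_isSepClosed`): if `K` is dense in `K(z)`, then for every polynomial
   `g` over `K` with `g(z) ≠ 0` the value `v g(a)` equals `v g(z)` for all `a ∈ K` close enough
   to `z` — condition (3) of Lemma 2.17. Elementary proof by Taylor expansion at `z`:
   `g(a) = g(z) + Σ_{1 ≤ n ≤ deg g} g^{[n]}(z) (a - z)ⁿ` with `g^{[n]}(z) ∈ K(z)` (Hasse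
   derivatives); by density ONE centre `a₀ ∈ K` satisfies `v(z - a₀) < v(g(z) / g^{[n]}(z))` for
   every `n` with `g^{[n]}(z) ≠ 0` (for `n = 0` this reads `v(z - a₀) < 1`), and then for
   `v(z - a) ≤ v(z - a₀)` every term of the sum has value
   `v(g^{[n]}(z)) v(z - a)ⁿ ≤ v(g^{[n]}(z)) v(z - a₀) < v g(z)`.
2. A dense extension is immediate (`IsDenseIn.exists_valuation_eq`, and density to within
   `v(1)` for the residues).
3. **Lemma 3.9** (`isSmoothlyUniformizableIn_of_immediate_of_kaplansky`,
   `ImmediateRationalUniformization.lean`, PROVED) concludes.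

Source: H. Knaf, F.-V. Kuhlmann, *Every place admits local uniformization in a finite extension
of the function field*, Adv. Math. 221 (2009) 428–453 = arXiv:math/0702856: Lemma 2.16 (p. 10;
its printed proof in the completion case: "one can show that if `f` does not satisfy (3), then
`vf(z) = ∞`. But this means that `f(z) = 0`, contradicting the assumption that `K(z)|K` is
transcendental"), Lemma 3.9, Prop. 3.11 (§3.4, p. 14). [KnafKuhlmann2009]
-/

noncomputable section

-- single-problem summit: the doubled namespace component is forced
set_option linter.dupNamespace false

namespace Summit.ResolutionOfSingularities.ResolutionOfSingularities.Theorems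

open Polynomial
open Literature.AlgebraicGeometry.Resolution

/-- **Density against finitely many bounds at once**: if `A` is dense in `B`, `y ∈ B`, and
`c i ∈ B^×` for `i` in a finite set `s`, then one `a ∈ A` has `v(y - a) < v(c i)` for all `i ∈ s`
(approximate to within the least of the finitely many values). [folklore] -/
theorem exists_forall_valuation_sub_lt_of_isDenseIn {Ω : Type*} [Field Ω]
    (V : ValuationSubring Ω) {A B : Subfield Ω} (h : IsDenseIn V A B) {y : Ω} (hy : y ∈ B)
    {ι : Type*} (s : Finset ι) (c : ι → Ω) (hc : ∀ i ∈ s, c i ∈ B ∧ c i ≠ 0) :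
    ∃ a ∈ A, ∀ i ∈ s, V.valuation (y - a) < V.valuation (c i) := by
  by_cases hs : s.Nonempty
  · obtain ⟨i₀, hi₀, hmin⟩ := Finset.exists_min_image s (fun i => V.valuation (c i)) hs
    obtain ⟨a, haA, ha⟩ := h y hy (c i₀) (hc i₀ hi₀).1 (hc i₀ hi₀).2
    exact ⟨a, haA, fun i hi => lt_of_lt_of_le ha (hmin i hi)⟩
  · exact ⟨0, A.zero_mem, fun i hi => (hs ⟨i, hi⟩).elim⟩

/-- A polynomial with coefficients in a subfield `E`, evaluated at a point of `E`, takes its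
value in `E`. [folklore] -/
theorem eval_mem_of_forall_coeff_mem {Ω : Type*} [Field Ω] (E : Subfield Ω) {P : Polynomial Ω}
    (hP : ∀ k, P.coeff k ∈ E) {x : Ω} (hx : x ∈ E) : P.eval x ∈ E := by
  rw [eval_eq_sum_range]
  exact sum_mem fun n _ => mul_mem (hP n) (pow_mem hx n)

/-- **Knaf–Kuhlmann 2009, Lemma 2.16, completion case** ("Let `(K(z)|K, P)` be an immediate
transcendental extension. Assume […] that `(K(z),P)` lies in the completion of `(K,P)`. Then
(3) holds", (3) being "`∀ f ∈ K[z] ∃ α, β ∈ vK ∀ a ∈ B(z, β): v f(a) = α`" with the balls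
`B(z, β) = {a ∈ K : v(z - a) ≥ β}`), sharp form
with `α = v f(z)`: if `K` is dense in `K(z)` and `g` is a polynomial over `K` with `g(z) ≠ 0`,
then there is a centre `a₀ ∈ K` such that `v g(a) = v g(z)` for all `a ∈ K` with
`v(z - a) ≥ v(z - a₀)` (values written multiplicatively: `≤`). PROVED by Taylor expansion at
`z`: `g(a) = g(z) + Σ_{1 ≤ n ≤ deg g} g^{[n]}(z) (a - z)ⁿ`; choose `a₀` by density with
`v(z - a₀) < v(g(z) / g^{[n]}(z))` for all `n` with `g^{[n]}(z) ≠ 0` (`n = 0`: `v(z - a₀) < 1`);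
then every term of the sum has value `< v g(z)`. [cite: KnafKuhlmann2009, Lemma 2.16] -/
theorem valuation_eval_eq_of_isDenseIn {Ω : Type*} [Field Ω] (V : ValuationSubring Ω)
    (K : Subfield Ω) {z : Ω} (hdense : IsDenseIn V K (Subfield.closure ((K : Set Ω) ∪ {z})))
    {g : Polynomial Ω} (hg : ∀ k, g.coeff k ∈ K) (hgz : g.eval z ≠ 0) :
    ∃ a₀ ∈ K, ∀ a ∈ K, V.valuation (z - a) ≤ V.valuation (z - a₀) →
      V.valuation (g.eval a) = V.valuation (g.eval z) := by
  classical
  set E := Subfield.closure ((K : Set Ω) ∪ {z}) with hE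
  have hKE : ∀ x ∈ K, x ∈ E := fun x hx => Subfield.subset_closure (Or.inl hx)
  have hzE : z ∈ E := Subfield.subset_closure (Or.inr rfl)
  have hgE : ∀ k, g.coeff k ∈ E := fun k => hKE _ (hg k)
  have hgzE : g.eval z ∈ E := eval_mem_of_forall_coeff_mem E hgE hzE
  -- the Taylor coefficients `g^{[n]}(z)` lie in `K(z)`
  have hTE : ∀ n, (taylor z g).coeff n ∈ E := fun n => coeff_taylor_mem E hgE hzE n
  -- Taylor expansion at `z`, the term `n = 0` split off
  have hexp : ∀ a : Ω, g.eval a = g.eval z +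
      ∑ n ∈ Finset.range g.natDegree, (taylor z g).coeff (n + 1) * (a - z) ^ (n + 1) := by
    intro a
    rw [← taylor_eval_sub z g a, eval_eq_sum_range (p := taylor z g) (a - z), natDegree_taylor,
      Finset.sum_range_succ', taylor_coeff_zero, pow_zero, mul_one, add_comm]
  -- one centre `a₀` below all the bounds `g(z) / g^{[n]}(z)`, `g^{[n]}(z) ≠ 0` (`n = 0`: `1`)
  obtain ⟨a₀, ha₀K, ha₀⟩ := exists_forall_valuation_sub_lt_of_isDenseIn V hdense hzE
    ((Finset.range (g.natDegree + 1)).filter fun n => (taylor z g).coeff n ≠ 0)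
    (fun n => g.eval z / (taylor z g).coeff n)
    (fun n hn => ⟨div_mem hgzE (hTE n), div_ne_zero hgz (Finset.mem_filter.mp hn).2⟩)
  have h1 : V.valuation (z - a₀) < 1 := by
    have h0 : (taylor z g).coeff 0 ≠ 0 := by rwa [taylor_coeff_zero]
    have h : V.valuation (z - a₀) < V.valuation (g.eval z / (taylor z g).coeff 0) :=
      ha₀ 0 (Finset.mem_filter.mpr ⟨Finset.mem_range.mpr (Nat.succ_pos _), h0⟩)
    rwa [taylor_coeff_zero, div_self hgz, map_one] at h
  have hTlt : ∀ n ∈ Finset.range (g.natDegree + 1), (taylor z g).coeff n ≠ 0 →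
      V.valuation ((taylor z g).coeff n) * V.valuation (z - a₀) < V.valuation (g.eval z) := by
    intro n hn hTn
    have hlt : V.valuation (z - a₀) < V.valuation (g.eval z / (taylor z g).coeff n) :=
      ha₀ n (Finset.mem_filter.mpr ⟨hn, hTn⟩)
    have hvT : V.valuation ((taylor z g).coeff n) ≠ 0 := (_root_.map_ne_zero _).mpr hTn
    calc V.valuation ((taylor z g).coeff n) * V.valuation (z - a₀)
        < V.valuation ((taylor z g).coeff n) *
            V.valuation (g.eval z / (taylor z g).coeff n) :=
          mul_lt_mul_of_pos_left hlt (zero_lt_iff.mpr hvT)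
      _ = V.valuation (g.eval z) := by rw [map_div₀, mul_div_cancel₀ _ hvT]
  -- on the ball around `a₀` every Taylor term of positive order is smaller than `g(z)`
  have hα : V.valuation (g.eval z) ≠ 0 := (_root_.map_ne_zero _).mpr hgz
  refine ⟨a₀, ha₀K, fun a _ hle => ?_⟩
  rw [hexp a, Valuation.map_add_eq_of_lt_left]
  refine Valuation.map_sum_lt _ hα fun n hn => ?_
  by_cases hTn : (taylor z g).coeff (n + 1) = 0
  · rw [hTn, zero_mul, map_zero]
    exact zero_lt_iff.mpr hα
  have hn' : n + 1 ∈ Finset.range (g.natDegree + 1) :=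
    Finset.mem_range.mpr (Nat.succ_lt_succ (Finset.mem_range.mp hn))
  have hza1 : V.valuation (z - a) ≤ 1 := hle.trans h1.le
  rw [map_mul, map_pow, Valuation.map_sub_swap V.valuation a z]
  calc V.valuation ((taylor z g).coeff (n + 1)) * V.valuation (z - a) ^ (n + 1)
      ≤ V.valuation ((taylor z g).coeff (n + 1)) * V.valuation (z - a) ^ 1 :=
        mul_le_mul_right (pow_le_pow_right_of_le_one' hza1 (Nat.le_add_left 1 n)) _
    _ ≤ V.valuation ((taylor z g).coeff (n + 1)) * V.valuation (z - a₀) := by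
        rw [pow_one]; exact mul_le_mul_right hle _
    _ < V.valuation (g.eval z) := hTlt (n + 1) hn' hTn

/-- **Knaf–Kuhlmann 2009, Lemma 2.16, completion case**, in the form of condition (3) of
Lemma 2.17 consumed by Lemma 3.9 (`isSmoothlyUniformizableIn_of_immediate_of_kaplansky`,
hypothesis `h3`): if `K` is dense in `K(z)` and `z` is transcendental over `K`, then for every
polynomial `g` over `K` the value `v g(a)` is constant for `a ∈ K` close enough to `z`
(`g = 0`: trivially; `g ≠ 0`: `g(z) ≠ 0` and `valuation_eval_eq_of_isDenseIn`).
[cite: KnafKuhlmann2009, Lemma 2.16] -/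
theorem kaplansky_condition_of_isDenseIn {Ω : Type*} [Field Ω] (V : ValuationSubring Ω)
    (K : Subfield Ω) {z : Ω}
    (htrans : ∀ P : Polynomial Ω, (∀ k, P.coeff k ∈ K) → P.eval z = 0 → P = 0)
    (hdense : IsDenseIn V K (Subfield.closure ((K : Set Ω) ∪ {z}))) :
    ∀ g : Polynomial Ω, (∀ k, g.coeff k ∈ K) → ∃ a₀ ∈ K, ∃ α : V.ValueGroup,
      ∀ a ∈ K, V.valuation (z - a) ≤ V.valuation (z - a₀) → V.valuation (g.eval a) = α := by
  intro g hg
  by_cases hg0 : g = 0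
  · exact ⟨0, K.zero_mem, 0, fun a _ _ => by rw [hg0, eval_zero, map_zero]⟩
  · have hgz : g.eval z ≠ 0 := fun h => hg0 (htrans g hg h)
    obtain ⟨a₀, ha₀, h⟩ := valuation_eval_eq_of_isDenseIn V K hdense hg hgz
    exact ⟨a₀, ha₀, V.valuation (g.eval z), h⟩

/-- **Knaf–Kuhlmann 2009, Prop. 3.11, transcendental step** (Lemma 2.16, completion case, +
Lemma 3.9): for a subfield `K` of the valued field `(Ω, V)` and `z ∈ Ω` transcendental over `K`
such that `K` is dense in `K(z)`, every finite `Z ⊆ O_V ∩ K(z)` is smoothly `O_K`-uniformizable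
in `K(z)` (`O_K = V ∩ K`): `K(z)|K` is immediate because dense, condition (3) holds by
`kaplansky_condition_of_isDenseIn`, and Lemma 3.9
(`isSmoothlyUniformizableIn_of_immediate_of_kaplansky`) applies.
[cite: KnafKuhlmann2009, Lemma 3.9] -/
theorem stub_denseTranscStep {Ω : Type} [Field Ω] [IsAlgClosed Ω] (V : ValuationSubring Ω)
    (K : Subfield Ω) (z : Ω)
    (htrans : ∀ P : Polynomial Ω, (∀ m, P.coeff m ∈ K) → P.eval z = 0 → P = 0)
    (hdense : IsDenseIn V K (Subfield.closure ((K : Set Ω) ∪ {z})))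
    (Z : Finset Ω) (hZ : ∀ w ∈ Z, w ∈ V ∧ w ∈ Subfield.closure ((K : Set Ω) ∪ {z})) :
    IsSmoothlyUniformizableIn ↥(V.toSubring ⊓ K.toSubring) V
      (Subfield.closure ((K : Set Ω) ∪ {z})) (Z : Set Ω) := by
  refine isSmoothlyUniformizableIn_of_immediate_of_kaplansky V K htrans ?_ ?_
    (kaplansky_condition_of_isDenseIn V K htrans hdense) Z hZ
  · intro w hw hw0
    obtain ⟨b, hbK, -, hb⟩ := hdense.exists_valuation_eq hw hw0
    exact ⟨b, hbK, hb.symm⟩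
  · intro w hw _hwV
    obtain ⟨c, hcK, hc⟩ := hdense w hw 1 (Subfield.closure ((K : Set Ω) ∪ {z})).one_mem
      one_ne_zero
    exact ⟨c, hcK, by rwa [map_one] at hc⟩

end Summit.ResolutionOfSingularities.ResolutionOfSingularities.Theorems

end
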